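import Literature.AlgebraicGeometry.HodgeTheory.ComplexTorusIntegralHodgeClassesLefschetzDecompositionKleimanProjectorsTransposedForms
import HarnessLib

/-!
# Kleiman's primitive projectors preserve the Hodge lattice ABOVE the middle degree: `N_{2k} · π_{2q,r}(x) ∈ Hdg^q(X, ℤ)` for `x ∈ Hdg^q(X, ℤ)`, `k + q = g`

Layer `Literature/AlgebraicGeometry/HodgeTheory`, namespace `Literature.AlgebraicGeometry.HodgeTheory.ComplexTorusCat`; lane `lit-hodgefound` (Track 2
foundations library, Layer A1/A4), prover seat `lit-hodgefound-p35` (gen 42, row g42-#9). The seat's g41-#2 `…LefschetzDecompositionKleimanProjectors` proved the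
LATTICE statement BELOW the middle degree — `N_{2k} · π_{2k,i}(x) ∈ Hdgᵏ(X, ℤ)` for every `x ∈ Hdgᵏ(X, ℤ)`, `2k ≤ g`, all the Lefschetz components of an integral Hodge
class are integral after multiplication by ONE explicit integer, the class being `(p_{2k,i})_*(x)` for Künnemann's explicit integral Lefschetz cycle `p_{2k,i}`
(g41-#4 recorded "Not here: the degrees `2k > g`"). g42-#7 `…KleimanProjectorsTransposedForms` computed the action of the TRANSPOSED cycles `τ_*p_{2k,i}` on ALL of
`H^{2g−2k}(X, ℂ)`: `N_{2k} · π_{2g−2k, g−2k+i}`. THIS FILE reads that back on the lattice: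

* §1 **`zsmul_primitiveProj_coe_mem_integralHodgeClasses_of_add_eq`** — for a complex torus `X` of dimension `g` (frame `eX`), `Θ ∈ NS(X)` non-degenerate with
  `Θ^{[g]} = D·[pt]`, `k + q = g` with `k ≤ q` (so `2q ≥ g`), EVERY `x ∈ Hdg^q(X, ℤ)` and EVERY `r`: **`N_{2k} · primitiveProj θ (2q) r (form of x) ∈ Hdg^q(X, ℤ)`**,
  `N_{2k} = lefschetzFamilyConstant g D 0 k` — in Milne's "`x = Σ_{i ≥ s−d} Lⁱxᵢ`" for an INTEGRAL Hodge class of degree `s = 2q ≥ d = g` every term satisfies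
  `N_{2k} · Lⁱxᵢ ∈ Hdg^q(X, ℤ)`; for `r` in Milne's range `q − k ≤ r ≤ q` the class is `(τ_*p_{2k, r−(q−k)})_*(x)` (the seat's action `p_{2*}(α · p₁^*x)` of g27, read on
  forms by ✔ g29-#2 `coe_integralHodgeClassesPushforward_sndHom_cup_pullbackHom_fstHom_eq_corrAct` and evaluated by g42-#7), outside it the projector is `0`;
* §2 **`…_of_isPolarizationType`** — polarized complex tori of type `(d₁, …, d_g)` (`Θ = θ`, `D = (−1)^g d₁⋯d_g`, `N_{2k} ≠ 0`).

With g41-#2 the primitive projectors `π_{m,r}` of EVERY even degree `m = 2q`, `0 ≤ q ≤ g`, preserve `Hdg•(X, ℤ) ⊗ ℤ[1/N]` for the explicit `N = N_{2 min(q, g−q)}`.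
Theorems only (kernel path): no definition, no named fact, no `sorry` (D-0026); frame-free statements (the auxiliary frames of `X × X`, `X × (X × X)` and the Tower's
codegrees are built from `eX` inside the proofs, as in g41-#2 §4).

## The sources, as printed

J. S. Milne, *Lefschetz classes on abelian varieties*, Duke Math. J. 96 (1999), held `paper:doi-10-1215-s0012-7094-99-09620-5`, §5 p. 664 (p0026 L46–L49): "Any
`x ∈ Hˢ(X)` can be written uniquely in the form `x = Σ_{i ≥ 0, s−d} Lⁱxᵢ` with `xᵢ` a primitive element of `H^{s−2i}(X)`"; Thm. 5.9 with proof (p0026 L74 – p0027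
L9): "all elements of the `ℚ`-algebra `ℚ[L, Λ]` are Lefschetz. Since this algebra contains `ᶜΛ` and `∗` (Kleiman 1968, 1.4.4)". C. Voisin, *Hodge Theory and Complex
Algebraic Geometry I* (2002), §6.2.3 Rem. 6.27 and §7.1.2 (the Lefschetz decomposition is compatible with the rational structure; the primitive components of a rational
class are rational). W. Fulton, *Intersection Theory* (2nd ed.), held, §16.1 Def. 16.1.1 (p0293 L12–L16: `α′ = τ_*(α)`), Def. 16.1.2 (p0295 L9–L13: `α_*(x) =
p_{Y*}(α · p_X^*x)`). H. Lange, *Abelian Varieties over the Complex Numbers* (2023), held, §7.3.2 (3) (p0338 L3–L16), §3.6 Thm. 3.6.1. K. Künnemann, Invent. Math. 113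
(1993) — not held (acq-10063), through Milne §5.

## References
* [Milne1999LefschetzClasses] J. S. Milne, Lefschetz classes on abelian varieties, Duke Math. J. 96 (1999) — §5 p. 664 (p0026 L46–L49), Thm. 5.9 with proof
  (p0026 L74 – p0027 L9).
* [Kleiman1968AlgebraicCycles] S. L. Kleiman, Algebraic cycles and the Weil conjectures (1968) — §1.4, 1.4.4 (through Milne).
* [VoisinHodgeI2002] C. Voisin, Hodge Theory and Complex Algebraic Geometry I, CUP 2002 — §6.2.3 Rem. 6.27, §7.1.2.
* [Fulton1998] W. Fulton, Intersection Theory, 2nd ed., Springer 1998 — §16.1 Def. 16.1.1 (p0293 L12–L16), Def. 16.1.2 (p0295 L9–L13).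
* [Lange2023AbelianVarietiesComplex] H. Lange, Abelian Varieties over the Complex Numbers, Springer 2023 — §7.3.2 (3) (p0338 L3–L16), §3.6 Thm. 3.6.1.
* [Kunnemann1993] K. Künnemann, A Lefschetz decomposition for Chow motives of abelian schemes, Invent. Math. 113 (1993) 85–102 (not held; through Milne §5).
-/

noncomputable section

open CategoryTheory Function

namespace Literature.AlgebraicGeometry.HodgeTheory

open Literature.AlgebraicGeometry.Motives Literature.AlgebraicGeometry.Motives.HodgeStructure
open Literature.Geometry.Kaehler Literature.Geometry.Kaehler.ComplexTorus
open Literature.LinearAlgebra.Alternating Literature.Analysis.Complex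

namespace ComplexTorusCat

/-! ## §0 Bookkeeping -/

/-- `dim_ℂ E = g` from a frame `Fin (2g) ≃ ι` of the lattice. [cite: Lange2023AbelianVarietiesComplex, §1.1.2 (p0021 L5)] -/
private theorem finrank_eq₄₄ (X : ComplexTorusCat) {gX : ℕ} (eX : Fin (2 * gX) ≃ X.toIsog.ι) : Module.finrank ℂ X.toIsog.E = gX := by
  have h := finrank_complex_mul_two X.toIsog.Φ eX
  omega

/-- The Tower's codegrees for the frames `X × X`, `X × (X × X)` built from `eX` (`g = b + 1`; `gXX = 2g`, `gT = 3g`, `c₁ = g + 1`, `bc = g + b`, `m₂ = b`, `d₂ = g + b + 1`,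
`l₁ = 2b`, `l₇ = 2g + 2`, `l₉ = 2g`), in the order of the Tower's variables. [folklore] -/
private theorem tower_degrees₄₄ {gX b : ℕ} (hb : gX = b + 1) :
    2 * gX + 2 * 0 = 2 * gX ∧ gX + gX = 2 * gX ∧ 2 * gX + 2 * gX = 2 * (gX + gX) ∧ (gX + gX) + (gX + gX) = 2 * (gX + gX) ∧
      (gX + (gX + gX)) + (gX + (gX + gX)) = 2 * (gX + (gX + gX)) ∧ 2 * gX + 2 * (gX + gX) = 2 * (gX + (gX + gX)) ∧ gX + gX = gX + gX ∧
      (gX + b) + 1 = gX + gX ∧ 2 * b + 2 * 1 = 2 * gX ∧ 2 * b + 2 * (gX + 1) = 2 * (gX + gX) ∧ (2 * gX + 2) + 2 * (gX + b) = 2 * (gX + (gX + gX)) ∧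
      (2 * gX + 2) + 2 * b = 2 * (gX + gX) ∧ b + gX = gX + b ∧ b + (gX + 1) = gX + b + 1 ∧ 2 * gX + 2 * (gX + b + 1) = 2 * (gX + (gX + gX)) ∧
      2 * gX + 2 * gX = 2 * (gX + gX) := by
  omega

/-- The degrees of the transposed complete tower on `H^{2q}`, `k + q = g`, for a projector index `r` in Milne's range `q − k ≤ r ≤ q`. [folklore] -/
private theorem deg_above₄₄ {gX k q r : ℕ} (hkq : k + q = gX) (hk : k ≤ q) (hr : q - k ≤ r) (hr' : r ≤ q) :
    (0 + 2 * k) + (q - k) = gX ∧ 2 * (q - k) + (0 + 2 * k) = 2 * q ∧ 2 * q + (0 + 2 * k) = 2 * gX ∧ 2 * gX = (0 + 2 * k) + 2 * q ∧ 0 + 2 * k ≤ gX + 1 ∧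
      r - (q - k) < k + 1 ∧ q - k + (r - (q - k)) = r ∧ (0 + 2 * k) + 2 * (gX + q) = 2 * (gX + gX) ∧ (0 + 2 * k) + 2 * q = 2 * gX := by
  omega

section FormAlgebra

variable {E : Type*} [NormedAddCommGroup E] [NormedSpace ℂ E] [FiniteDimensional ℂ E] {η : E [⋀^Fin 2]→L[ℝ] ℝ}
  (hnd : ∀ v : E, v ≠ 0 → ∃ w : E, η ![v, w] ≠ 0)

/-- `π_{0,0} = 1` on `H⁰` (the only summand). [cite: Milne1999LefschetzClasses, §5 p. 664 (p0026 L46–L49)] -/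
private theorem primitiveProj_two_mul_zero_apply₄₄ (y : E [⋀^Fin (2 * 0)]→L[ℝ] ℂ) : primitiveProj η (2 * 0) 0 y = y := by
  have h := sum_range_primitiveProj (η := η) (m := 2 * 0) (Nat.zero_le _)
  rw [Nat.mul_div_cancel_left 0 (by norm_num : 0 < 2), zero_add, Finset.sum_range_one] at h
  rw [h, Module.End.one_apply]

include hnd in
/-- **The projectors beyond the middle of the range vanish: `π_{m,i} = 0` for `m < 2i`** (`m ≤ 2g`). [cite: Milne1999LefschetzClasses, §5 p. 664 (p0026 L46–L49)] -/
private theorem primitiveProj_eq_zero_of_lt_two_mul₄₄ {m i : ℕ} (hm : m ≤ 2 * Module.finrank ℂ E) (hi : m < 2 * i) : primitiveProj η m i = 0 := by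
  refine linearMap_ext_of_lefschetzPow hnd hm fun r k h hr α hα ↦ ?_
  rw [LinearMap.zero_apply, primitiveProj_lefschetzPow_of_mem_primitiveForms hnd h hr hα, if_neg (by omega)]

end FormAlgebra

/-! ## §1 The lattice statement above the middle degree -/

section Lattice

variable (X : ComplexTorusCat) {gX : ℕ} (eX : Fin (2 * gX) ≃ X.toIsog.ι) (Θ : neronSeveriGroup X.toIsog.Φ) (D : ℤ)
  (hnd : ∀ v : X.toIsog.E, v ≠ 0 → ∃ w : X.toIsog.E, (Θ : X.toIsog.E [⋀^Fin 2]→L[ℝ] ℝ) ![v, w] ≠ 0)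

include hnd in
/-- **`N_{2k} · π_{2q,r}(Hdg^q(X, ℤ)) ⊆ Hdg^q(X, ℤ)` FOR `k + q = g`, `k ≤ q`, AND EVERY `r` — KLEIMAN'S PRIMITIVE PROJECTORS PRESERVE THE LATTICE OF INTEGRAL HODGE CLASSES ABOVE THE
MIDDLE DEGREE, UP TO THE ONE EXPLICIT INTEGER `N_{2k} = lefschetzFamilyConstant g D 0 k = Π_{j<k} (g−2j)·(g!/(g−2j)!)·D`.** For a complex torus `X` of dimension `g` (frame
`eX`), `Θ ∈ NS(X)` non-degenerate with `Θ^{[g]} = D·[pt]` and `x ∈ Hdg^q(X, ℤ)`, `2q ≥ g`: in Milne's range `q − k ≤ r ≤ q` the class `N_{2k} · π_{2q,r}(x)` is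
`(τ_*p_{2k, r−(q−k)})_*(x)`, the action of the TRANSPOSE of Künnemann's explicit integral Lefschetz cycle (g42-#7 `corrAct_domDomCongr_coe_pushforward_swapHom_lefschetzFamily`
read on the lattice through ✔ g29-#2); outside the range `π_{2q,r} = 0`. The companion of g41-#2 `zsmul_primitiveProj_coe_mem_integralHodgeClasses_of_le` (`2q ≤ g`).
[cite: Milne1999LefschetzClasses, §5 p. 664 (p0026 L46–L49) and Thm. 5.9 with proof (p0026 L74 – p0027 L9)] [cite: Kleiman1968AlgebraicCycles, §1.4, 1.4.4]
[cite: VoisinHodgeI2002, §6.2.3 Rem. 6.27 and §7.1.2] [cite: Fulton1998, §16.1 Def. 16.1.1 and Def. 16.1.2 (p0293 L12–L16, p0295 L9–L13)] [cite: Kunnemann1993] -/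
theorem zsmul_primitiveProj_coe_mem_integralHodgeClasses_of_add_eq (hΘ : nsDivPower X Θ gX = D • pointIntegralHodgeClass X eX) {k q : ℕ} (hkq : k + q = gX)
    (hk : k ≤ q) (r : ℕ) (x : integralHodgeClasses X.toIsog.Φ q) :
    lefschetzFamilyConstant gX D 0 k • primitiveProj (Θ : X.toIsog.E [⋀^Fin 2]→L[ℝ] ℝ) (2 * q) r ((x : integralHodgeClasses X.toIsog.Φ q) : X.toIsog.E [⋀^Fin (2 * q)]→L[ℝ] ℂ) ∈
      integralHodgeClasses X.toIsog.Φ q := by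
  -- outside Milne's range `q − k ≤ r ≤ q` the projector vanishes
  rcases Nat.lt_or_ge r (q - k) with hr | hr
  · rw [primitiveProj_eq_zero_of_lt hnd (by rw [finrank_eq₄₄ X eX]; omega) (by rw [finrank_eq₄₄ X eX]; omega), LinearMap.zero_apply, smul_zero]
    exact zero_mem _
  rcases Nat.lt_or_ge q r with hr' | hr'
  · rw [primitiveProj_eq_zero_of_lt_two_mul₄₄ hnd (by rw [finrank_eq₄₄ X eX]; omega) (by omega : 2 * q < 2 * r), LinearMap.zero_apply, smul_zero]
    exact zero_mem _
  -- the degenerate torus `g = 0`: `q = k = r = 0`, `N₀ = 1`, `π_{0,0} = 1`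
  rcases Nat.eq_zero_or_pos q with hq0 | hq0
  · subst hq0
    obtain rfl : k = 0 := by omega
    obtain rfl : r = 0 := by omega
    rw [lefschetzFamilyConstant_zero, one_smul, primitiveProj_two_mul_zero_apply₄₄]
    exact SetLike.coe_mem x
  -- `g = b + 1`; frames of `X × X`, `X × (X × X)` built from `eX`; the Tower's codegrees
  obtain ⟨b, hb⟩ : ∃ b, gX = b + 1 := ⟨gX - 1, by omega⟩
  obtain ⟨hX0, hgX, hcX, hgXX, hgT, hN', hgg₂, hbc₁, hl₁, hl₁', h7, h7', hmX, hΛL, h9, h9'⟩ := tower_degrees₄₄ hb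
  obtain ⟨hj, hs', h2q, hQ', hk1, hik, hri, hXq, hYq⟩ := deg_above₄₄ hkq hk hr hr'
  let eXX : Fin (2 * (gX + gX)) ≃ (prodObj X X).toIsog.ι := (finCongr hcX.symm).trans (finSumFinEquiv.symm.trans (eX.sumCongr eX))
  let eT : Fin (2 * (gX + (gX + gX))) ≃ (prodObj X (prodObj X X)).toIsog.ι := (finCongr hN'.symm).trans (finSumFinEquiv.symm.trans (eX.sumCongr eXX))
  let e₂ : Fin (2 * q + (0 + 2 * k)) ≃ X.toIsog.ι := (finCongr h2q).trans eX
  -- `(τ_*p)_*(x)` is an integral Hodge class whose form is `corrAct e₂ (τ_*p) x` (g29-#2) `= N_{2k} · π_{2q,r}(x)` (g42-#7)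
  have key := coe_integralHodgeClassesPushforward_sndHom_cup_pullbackHom_fstHom_eq_corrAct eXX eX e₂ (rfl : gX + q = gX + q) hXq hgXX hYq hgX hQ'
    (integralHodgeClassesPushforward gX gX (swapHom X X) eXX eXX hcX hgXX hcX hgXX
      (lefschetzFamily X eX eXX eT hX0 hgX hcX hgXX hgT hN' hgg₂ Θ D hbc₁ hl₁ hl₁' h7 h7' hmX hΛL h9 h9' 0 k hk1 ⟨r - (q - k), hik⟩)) x
  rw [corrAct_domDomCongr_coe_pushforward_swapHom_lefschetzFamily_of_le_one X eX eXX eT hX0 hgX hcX hgXX hgT hN' hgg₂ Θ D hbc₁ hl₁ hl₁' h7 h7' hmX hΛL h9 h9' hnd hΘ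
    (Nat.zero_le 1) k hk1 hj hs' e₂ hQ' ⟨r - (q - k), hik⟩, Fin.val_mk, hri] at key
  rw [← key]
  exact SetLike.coe_mem _

end Lattice

/-! ## §2 Polarized complex tori of type `(d₁, …, d_g)` -/

section Polarized

variable (X : ComplexTorusCat) {gX : ℕ} (eX : Fin (2 * gX) ≃ X.toIsog.ι) {θ : neronSeveriGroup X.toIsog.Φ} (hθ : IsRiemannForm X.toIsog.Φ (θ : X.toIsog.E [⋀^Fin 2]→L[ℝ] ℝ))
  {d : Fin gX → ℕ} (hd : IsPolarizationType X.toIsog.Φ (θ : X.toIsog.E [⋀^Fin 2]→L[ℝ] ℝ) d)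

include eX hθ hd in
/-- **ON A POLARIZED COMPLEX TORUS `(X, θ)` OF TYPE `(d₁, …, d_g)`: `N_{2k} · π_{2q,r}(x) ∈ Hdg^q(X, ℤ)` for every `x ∈ Hdg^q(X, ℤ)`, `k + q = g`, `k ≤ q`, every `r`**, with
`N_{2k} = lefschetzFamilyConstant g ((−1)^g d₁⋯d_g) 0 k ≠ 0` (g40 `lefschetzFamilyConstant_ne_zero`): above the middle degree too, the Lefschetz components of an integral
Hodge class of a polarized abelian variety are integral up to one explicit integer. [cite: Milne1999LefschetzClasses, §5 p. 664 (p0026 L46–L49) and Thm. 5.9 with proof (p0026 L74 – p0027 L9)]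
[cite: Lange2023AbelianVarietiesComplex, §3.6 Thm. 3.6.1 and §7.3.2 (3) (p0338 L3–L16)] [cite: Kunnemann1993] -/
theorem zsmul_primitiveProj_coe_mem_integralHodgeClasses_of_add_eq_of_isPolarizationType {k q : ℕ} (hkq : k + q = gX) (hk : k ≤ q) (r : ℕ)
    (x : integralHodgeClasses X.toIsog.Φ q) :
    lefschetzFamilyConstant gX ((-1 : ℤ) ^ gX * ∏ i, (d i : ℤ)) 0 k •
        primitiveProj (θ : X.toIsog.E [⋀^Fin 2]→L[ℝ] ℝ) (2 * q) r ((x : integralHodgeClasses X.toIsog.Φ q) : X.toIsog.E [⋀^Fin (2 * q)]→L[ℝ] ℂ) ∈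
      integralHodgeClasses X.toIsog.Φ q :=
  zsmul_primitiveProj_coe_mem_integralHodgeClasses_of_add_eq X eX θ _ (IsRiemannForm.exists_apply_ne_zero X.toIsog.Φ hθ)
    (nsDivPower_top_eq_zsmul_pointIntegralHodgeClass X eX hθ hd) hkq hk r x

end Polarized

end ComplexTorusCat

end Literature.AlgebraicGeometry.HodgeTheory

end
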